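import Literature.MathematicalPhysics.QuantumLattice.SectorSymbolMasterZero
import Literature.MathematicalPhysics.QuantumLattice.SectorPropagatorL1
import Literature.Analysis.Calculus.SymmetricSecondDifference
import Mathlib.MeasureTheory.Measure.Haar.Unique
import HarnessLib

/-!
# The improved bound at coinciding points: `|g^{(h)}_ω(0)| ≤ C γ^{(5/2)h}` (BGM 2006, Lemma 2.2a)

Topic `Literature/MathematicalPhysics/QuantumLattice`; the endpoint of the chain
`SectorSymbolMasterBox` (uniform support box, reflection symmetry) → `SectorSymbolMasterZero`
(shear antisymmetry at `s = 0`) → `Analysis/Calculus/SymmetricSecondDifference`. In the master-function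
language of `SectorSymbolMaster`, `g^{(h)}_ω(0) = |det A| ∫ R = 4^{-n}4^{-n}2^{-n} · 4ⁿ · J(θ_{h,ω}, 2^{-n})`
with the **scale integral** `J(θ, s) = ∫ Φ̂(θ, t; s) dt` (written in the coordinates
`(t₀, (t₂, t₁)) ∈ ℝ × ℝ × ℝ`). PROVED here:

* `masterScaleIntegral_zero` — `J(θ, 0) = 0` (BGM's "the first integral is zero by oddity", (2.56e)):
  the measure-preserving involution `(t₀, t₂, t₁) ↦ (-t₀, t₂, -t₁ - δ(θ,t₂))` changes the sign of
  the integrand (`masterSymbol_zero_shear`);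
* `masterScaleIntegral_neg` — `J(θ, -s) = J(θ, s)` (the reflection `t₂ ↦ -t₂`, `masterSymbol_reflect`);
* `norm_masterScaleIntegral_le` — `‖J(θ, s)‖ ≤ C s²` for `|s| ≤ 1`, `θ ∈ [0, 2π]` (pointwise symmetric
  second differences in `s`, the second `s`-derivative of the master symbol being bounded on the
  compact parameter × box set, and the support lying in the uniform box);
* `sectorPropagator_zero_eq` — `g^{(-n)}_ω(0, 0) = (4^{-n}4^{-n}2^{-n} · 4ⁿ) J(θ_{n,ω}, 2^{-n})`;
* **`norm_sectorPropagator_zero_le`** — Lemma 2.2a: `‖g^{(-n)}_ω(0, 0)‖ ≤ C · 4^{-n}4^{-n}2^{-n}`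
  (`= Cγ^{(5/2)h}`, a factor `γ^h` better than (2.52)), for all `n` and all sectors `0 ≤ ω < 2^{n+1}`.

Everything is PROVED; the definitions are the coordinate symbol `masterSymbolQ`, the scale
integral `masterScaleIntegral`, the coordinate equivalence `momToQ` and the two involutions.

## Sources

* G. Benfatto, A. Giuliani, V. Mastropietro, Ann. Henri Poincaré 7 (2006) 809–898, §2.5
  Lemma 2.2a, (2.56a)–(2.56e) (arXiv:cond-mat/0507686 p. 11). [BenfattoGiulianiMastropietro2006]
-/

noncomputable section

open Real Set Complex Function Metric Filter MeasureTheory MeasureTheory.Measure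
open scoped Topology FourierTransform
open Literature.Analysis.Calculus Literature.Analysis.Fourier

namespace Literature.MathematicalPhysics.QuantumLattice

/-- Shorthand for the coordinate space `ℝ × (ℝ × ℝ)` of `(t₀, (t₂, t₁))`. [folklore] -/
abbrev QSpace := ℝ × (ℝ × ℝ)

/-! ### The coordinate symbol and the scale integral -/

/-- The master symbol in the coordinates `q = (t₀, (t₂, t₁))`. [cite: BenfattoGiulianiMastropietro2006, §2.5 Lemma 2.2a] -/
def masterSymbolQ (μ e₀ θ s : ℝ) (q : QSpace) : ℂ :=
  masterSymbol μ e₀ (θ, q.2.2, q.2.1) q.1 s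

/-- **The scale integral** `J(θ, s) = ∫ Φ̂(θ, t; s) dt`. [cite: BenfattoGiulianiMastropietro2006, §2.5 Lemma 2.2a (2.56c)] -/
def masterScaleIntegral (μ e₀ θ s : ℝ) : ℂ := ∫ q : QSpace, masterSymbolQ μ e₀ θ s q

/-- `(k₁, k₂) ↦ (k₂, k₁)` as a measurable equivalence `ℝ² ≃ ℝ × ℝ`. [folklore] -/
def finTwoSwap : (Fin 2 → ℝ) ≃ᵐ ℝ × ℝ := MeasurableEquiv.finTwoArrow.trans MeasurableEquiv.prodComm

/-- `finTwoSwap k = (k 1, k 0)`. [folklore] -/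
theorem finTwoSwap_apply (k : Fin 2 → ℝ) : finTwoSwap k = (k 1, k 0) := by
  simp [finTwoSwap, MeasurableEquiv.trans_apply, MeasurableEquiv.finTwoArrow_apply, MeasurableEquiv.prodComm]

/-- `finTwoSwap` preserves the measure. [folklore] -/
theorem measurePreserving_finTwoSwap : MeasurePreserving finTwoSwap (volume : Measure (Fin 2 → ℝ)) (volume : Measure (ℝ × ℝ)) := by
  have h1 := volume_preserving_finTwoArrow ℝ
  have h2 : MeasurePreserving (Prod.swap : ℝ × ℝ → ℝ × ℝ) (volume : Measure (ℝ × ℝ)) (volume : Measure (ℝ × ℝ)) :=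
    Measure.measurePreserving_swap
  exact h2.comp h1

/-- The coordinate equivalence `t ↦ (t₀, (t₂, t₁))` of `ℝ³`. [folklore] -/
def momToQ : MomSpace ≃ᵐ QSpace :=
  splitMomentum.trans (MeasurableEquiv.prodCongr (MeasurableEquiv.refl ℝ) finTwoSwap)

/-- `momToQ t = (t 0, (t 2, t 1))`. [folklore] -/
theorem momToQ_apply (t : MomSpace) : momToQ t = (t 0, (t 2, t 1)) := by
  simp [momToQ, MeasurableEquiv.trans_apply, splitMomentum_apply, MeasurableEquiv.prodCongr, finTwoSwap_apply]

/-- `momToQ` preserves the measure. [folklore] -/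
theorem measurePreserving_momToQ : MeasurePreserving momToQ (volume : Measure MomSpace) (volume : Measure QSpace) := by
  have h2 : MeasurePreserving (Prod.map id finTwoSwap : ℝ × (Fin 2 → ℝ) → QSpace) volume volume :=
    (MeasurePreserving.id (volume : Measure ℝ)).prod measurePreserving_finTwoSwap
  exact h2.comp measurePreserving_splitMomentum

/-- The lift and the coordinate symbol agree through `momToQ`. [folklore] -/
theorem masterLift_eq_masterSymbolQ (μ e₀ θ s : ℝ) (t : MomSpace) :
    masterLift μ e₀ ((θ, s), t) = masterSymbolQ μ e₀ θ s (momToQ t) := by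
  simp [masterLift, masterSymbolQ, momToQ_apply]

/-- Hence **`∫ Φ̂((θ,s), t) dt = J(θ, s)`**. [folklore] -/
theorem integral_masterLift (μ e₀ θ s : ℝ) : ∫ t : MomSpace, masterLift μ e₀ ((θ, s), t) = masterScaleIntegral μ e₀ θ s := by
  simp_rw [masterLift_eq_masterSymbolQ]
  exact measurePreserving_momToQ.integral_comp momToQ.measurableEmbedding _

/-! ### Continuity, support and integrability -/

section Main

variable {μ : ℝ} (hμ₁ : -4 < μ) (hμ₂ : μ < -2 - Real.sqrt 2)
include hμ₁ hμ₂

omit hμ₁ hμ₂ in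
/-- The embedding `q ↦ ((θ, s), t(q))`. [folklore] -/
theorem continuous_qEmbed (θ s : ℝ) :
    Continuous fun q : QSpace => (((θ, s) : ℝ × ℝ), (WithLp.toLp 2 ![q.1, q.2.2, q.2.1] : MomSpace)) := by
  refine continuous_const.prodMk ((PiLp.continuous_toLp 2 _).comp (continuous_pi fun i => ?_))
  fin_cases i
  · exact continuous_fst
  · exact continuous_snd.comp continuous_snd
  · exact continuous_fst.comp continuous_snd

omit hμ₁ hμ₂ in
/-- The coordinate symbol through the lift. [folklore] -/
theorem masterSymbolQ_eq_masterLift (μ e₀ θ s : ℝ) (q : QSpace) :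
    masterSymbolQ μ e₀ θ s q = masterLift μ e₀ ((θ, s), WithLp.toLp 2 ![q.1, q.2.2, q.2.1]) := by
  simp [masterLift, masterSymbolQ]

/-- The coordinate symbol is continuous in `q` (`0 < e₀`). [folklore] -/
theorem continuous_masterSymbolQ {e₀ : ℝ} (he : 0 < e₀) (θ s : ℝ) : Continuous (masterSymbolQ μ e₀ θ s) := by
  have h := (contDiff_masterLift hμ₁ hμ₂ he (μ := μ)).continuous.comp (continuous_qEmbed θ s)
  exact h.congr fun q => (masterSymbolQ_eq_masterLift μ e₀ θ s q).symm

/-- The box in coordinates. [folklore] -/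
def masterBoxQ (μ e₀ : ℝ) : Set QSpace :=
  {q | |q.1| ≤ e₀ ∧ |q.2.2| ≤ normalExtentConst μ e₀ ∧ |q.2.1| ≤ tangentExtentConst μ e₀}

/-- **The uniform support box in coordinates**: for `|s| ≤ 1`, `masterSymbolQ θ s q ≠ 0 ⟹ q ∈ box`
(negative `s` through the reflection symmetry). [cite: BenfattoGiulianiMastropietro2003, §7.1 Lemma 7.3] -/
theorem mem_masterBoxQ_of_ne_zero {e₀ : ℝ} (he : 0 < e₀) (he' : e₀ ≤ (4 + μ) / 2) {θ s : ℝ}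
    (hs : s ∈ Icc (-1 : ℝ) 1) {q : QSpace} (h : masterSymbolQ μ e₀ θ s q ≠ 0) : q ∈ masterBoxQ μ e₀ := by
  rcases le_or_gt 0 s with h0 | h0
  · exact abs_le_of_masterSymbol_ne_zero_of_mem_Icc hμ₁ hμ₂ he he' ⟨h0, hs.2⟩ h
  · have hrefl : masterSymbolQ μ e₀ θ s q = masterSymbol μ e₀ (θ, q.2.2, -q.2.1) q.1 (-s) := by
      rw [masterSymbolQ, ← masterSymbol_reflect hμ₁ hμ₂ e₀ θ q.1 q.2.2 q.2.1 s]
    rw [hrefl] at h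
    have := abs_le_of_masterSymbol_ne_zero_of_mem_Icc hμ₁ hμ₂ he he' ⟨by linarith, by linarith [hs.1]⟩ h
    rw [abs_neg] at this
    exact this

omit hμ₁ hμ₂ in
/-- The box is closed. [folklore] -/
theorem isClosed_masterBoxQ (μ e₀ : ℝ) : IsClosed (masterBoxQ μ e₀) :=
  (isClosed_le (continuous_abs.comp continuous_fst) continuous_const).inter
    ((isClosed_le (continuous_abs.comp (continuous_snd.comp continuous_snd)) continuous_const).inter
      (isClosed_le (continuous_abs.comp (continuous_fst.comp continuous_snd)) continuous_const))

omit hμ₁ hμ₂ in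
/-- The box inside a product of intervals. [folklore] -/
theorem masterBoxQ_subset (μ e₀ : ℝ) :
    masterBoxQ μ e₀ ⊆ Icc (-e₀) e₀ ×ˢ (Icc (-tangentExtentConst μ e₀) (tangentExtentConst μ e₀) ×ˢ
      Icc (-normalExtentConst μ e₀) (normalExtentConst μ e₀)) := by
  rintro ⟨a, b, c⟩ ⟨h1, h2, h3⟩
  exact ⟨abs_le.1 h1, abs_le.1 h3, abs_le.1 h2⟩

omit hμ₁ hμ₂ in
/-- The box is compact. [folklore] -/
theorem isCompact_masterBoxQ (μ e₀ : ℝ) : IsCompact (masterBoxQ μ e₀) :=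
  (isCompact_Icc.prod (isCompact_Icc.prod isCompact_Icc)).of_isClosed_subset (isClosed_masterBoxQ μ e₀) (masterBoxQ_subset μ e₀)

omit hμ₁ hμ₂ in
/-- The measure of the box is at most `2e₀ · 2C₂ · 2C₁`. [folklore] -/
theorem volume_masterBoxQ_le {μ e₀ : ℝ} :
    volume (masterBoxQ μ e₀) ≤ ENNReal.ofReal (2 * e₀) * (ENNReal.ofReal (2 * tangentExtentConst μ e₀) *
      ENNReal.ofReal (2 * normalExtentConst μ e₀)) := by
  refine (measure_mono (masterBoxQ_subset μ e₀)).trans ?_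
  rw [Measure.volume_eq_prod, Measure.prod_prod, Measure.volume_eq_prod, Measure.prod_prod, Real.volume_Icc,
    Real.volume_Icc, Real.volume_Icc]
  apply le_of_eq
  congr 1 <;> [congr 1; congr 1] <;> ring_nf

/-- Off the box the symbol vanishes (`|s| ≤ 1`). [folklore] -/
theorem masterSymbolQ_eq_zero_of_notMem {e₀ : ℝ} (he : 0 < e₀) (he' : e₀ ≤ (4 + μ) / 2) {θ s : ℝ}
    (hs : s ∈ Icc (-1 : ℝ) 1) {q : QSpace} (hq : q ∉ masterBoxQ μ e₀) : masterSymbolQ μ e₀ θ s q = 0 := by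
  by_contra h
  exact hq (mem_masterBoxQ_of_ne_zero hμ₁ hμ₂ he he' hs h)

/-- The symbol has compact support in the box (`|s| ≤ 1`). [folklore] -/
theorem tsupport_masterSymbolQ_subset {e₀ : ℝ} (he : 0 < e₀) (he' : e₀ ≤ (4 + μ) / 2) (θ : ℝ) {s : ℝ}
    (hs : s ∈ Icc (-1 : ℝ) 1) : tsupport (masterSymbolQ μ e₀ θ s) ⊆ masterBoxQ μ e₀ :=
  closure_minimal (fun q hq => by
    by_contra h; exact hq (masterSymbolQ_eq_zero_of_notMem hμ₁ hμ₂ he he' hs h)) (isClosed_masterBoxQ μ e₀)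

/-- The symbol is integrable (`|s| ≤ 1`). [folklore] -/
theorem integrable_masterSymbolQ {e₀ : ℝ} (he : 0 < e₀) (he' : e₀ ≤ (4 + μ) / 2) (θ : ℝ) {s : ℝ}
    (hs : s ∈ Icc (-1 : ℝ) 1) : Integrable (masterSymbolQ μ e₀ θ s) :=
  (continuous_masterSymbolQ hμ₁ hμ₂ he θ s).integrable_of_hasCompactSupport
    ((isCompact_masterBoxQ μ e₀).of_isClosed_subset (isClosed_tsupport _) (tsupport_masterSymbolQ_subset hμ₁ hμ₂ he he' θ hs))

/-! ### `J(θ, 0) = 0`: the shear involution -/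

/-- The shear `(t₀, (t₂, t₁)) ↦ (-t₀, (t₂, -t₁ - δ(θ, t₂)))`. [cite: BenfattoGiulianiMastropietro2006, §2.5 Lemma 2.2a (2.56e)] -/
def shearQ (μ θ : ℝ) (q : QSpace) : QSpace := (-q.1, (q.2.1, -q.2.2 - zeroShift μ θ q.2.1))

/-- `δ(θ, ·)` is continuous. [folklore] -/
theorem continuous_zeroShift (θ : ℝ) : Continuous fun b : ℝ => zeroShift μ θ b := by
  unfold zeroShift
  refine ((continuous_const.mul ?_).div_const _)
  exact (contDiff_rescaledDispersion hμ₁ hμ₂ (μ := μ)).continuous.comp (by fun_prop)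

/-- **The shear preserves the Lebesgue measure** (a reflection times a measure-preserving skew product). [folklore] -/
theorem measurePreserving_shearQ (θ : ℝ) : MeasurePreserving (shearQ μ θ) (volume : Measure QSpace) volume := by
  have hneg : MeasurePreserving (Neg.neg : ℝ → ℝ) volume volume := Measure.measurePreserving_neg _
  have hskew : MeasurePreserving (fun p : ℝ × ℝ => (p.1, -p.2 - zeroShift μ θ p.1)) (volume : Measure (ℝ × ℝ)) volume := by
    rw [Measure.volume_eq_prod]
    refine (MeasurePreserving.id (volume : Measure ℝ)).skew_product (g := fun a b => -b - zeroShift μ θ a) ?_ ?_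
    · exact (continuous_snd.neg.sub ((continuous_zeroShift hμ₁ hμ₂ θ).comp continuous_fst)).measurable
    · refine ae_of_all _ fun a => ?_
      have hfun : (fun b : ℝ => -b - zeroShift μ θ a) = (Neg.neg : ℝ → ℝ) ∘ fun x => x + zeroShift μ θ a := by
        funext b; simp only [Function.comp_apply, neg_add_rev]; ring
      have h1 : MeasurePreserving (fun b : ℝ => -b - zeroShift μ θ a) volume volume := by
        rw [hfun]; exact hneg.comp (measurePreserving_add_right (volume : Measure ℝ) (zeroShift μ θ a))
      exact h1.map_eq
  have := hneg.prod hskew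
  rw [Measure.volume_eq_prod]
  exact this

/-- The integrand changes sign under the shear at `s = 0`. [cite: BenfattoGiulianiMastropietro2006, §2.5 Lemma 2.2a (2.56e)] -/
theorem masterSymbolQ_shearQ (e₀ θ : ℝ) (q : QSpace) :
    masterSymbolQ μ e₀ θ 0 (shearQ μ θ q) = -masterSymbolQ μ e₀ θ 0 q := by
  simp only [masterSymbolQ, shearQ]
  exact masterSymbol_zero_shear hμ₁ hμ₂ e₀ θ q.1 q.2.2 q.2.1

/-- **`J(θ, 0) = 0`** ("the first integral is zero by oddity", BGM (2.56e)). [cite: BenfattoGiulianiMastropietro2006, §2.5 Lemma 2.2a (2.56e)] -/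
theorem masterScaleIntegral_zero {e₀ : ℝ} (he : 0 < e₀) (θ : ℝ) : masterScaleIntegral μ e₀ θ 0 = 0 := by
  have hσ := measurePreserving_shearQ hμ₁ hμ₂ θ (μ := μ)
  have hcont := continuous_masterSymbolQ hμ₁ hμ₂ he θ 0 (μ := μ) (e₀ := e₀)
  have h1 : ∫ q, masterSymbolQ μ e₀ θ 0 (shearQ μ θ q) = ∫ q, masterSymbolQ μ e₀ θ 0 q := by
    have := integral_map hσ.measurable.aemeasurable (hcont.aestronglyMeasurable (μ := Measure.map (shearQ μ θ) volume))
    rw [hσ.map_eq] at this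
    exact this.symm
  have h2 : ∫ q, masterSymbolQ μ e₀ θ 0 (shearQ μ θ q) = -∫ q, masterSymbolQ μ e₀ θ 0 q := by
    simp_rw [masterSymbolQ_shearQ hμ₁ hμ₂]
    exact integral_neg _
  rw [masterScaleIntegral]
  linear_combination (1 / 2 : ℂ) * (h1.symm.trans h2)

/-! ### `J(θ, -s) = J(θ, s)`: the reflection -/

omit hμ₁ hμ₂ in
/-- The reflection `(t₀, (t₂, t₁)) ↦ (t₀, (-t₂, t₁))`. [folklore] -/
def reflQ (q : QSpace) : QSpace := (q.1, (-q.2.1, q.2.2))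

omit hμ₁ hμ₂ in
/-- The reflection preserves the measure. [folklore] -/
theorem measurePreserving_reflQ : MeasurePreserving reflQ (volume : Measure QSpace) volume := by
  have hneg : MeasurePreserving (Neg.neg : ℝ → ℝ) volume volume := Measure.measurePreserving_neg _
  have h2 : MeasurePreserving (Prod.map Neg.neg id : ℝ × ℝ → ℝ × ℝ) (volume : Measure (ℝ × ℝ)) volume := by
    rw [Measure.volume_eq_prod]; exact hneg.prod (MeasurePreserving.id _)
  have := (MeasurePreserving.id (volume : Measure ℝ)).prod h2
  rw [Measure.volume_eq_prod]
  exact this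

/-- The symbol at `-s` is the symbol at `s` composed with the reflection. [folklore] -/
theorem masterSymbolQ_neg (e₀ θ s : ℝ) (q : QSpace) : masterSymbolQ μ e₀ θ (-s) q = masterSymbolQ μ e₀ θ s (reflQ q) := by
  simp only [masterSymbolQ, reflQ]
  have := masterSymbol_reflect hμ₁ hμ₂ e₀ θ q.1 q.2.2 (-q.2.1) s
  rw [neg_neg] at this
  exact this

/-- **`J(θ, -s) = J(θ, s)`.** [folklore] -/
theorem masterScaleIntegral_neg {e₀ : ℝ} (he : 0 < e₀) (θ s : ℝ) : masterScaleIntegral μ e₀ θ (-s) = masterScaleIntegral μ e₀ θ s := by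
  have hρ := measurePreserving_reflQ
  have hcont := continuous_masterSymbolQ hμ₁ hμ₂ he θ s (μ := μ) (e₀ := e₀)
  rw [masterScaleIntegral, masterScaleIntegral]
  simp_rw [masterSymbolQ_neg hμ₁ hμ₂]
  have := integral_map hρ.measurable.aemeasurable (hcont.aestronglyMeasurable (μ := Measure.map reflQ volume))
  rw [hρ.map_eq] at this
  exact this.symm

/-! ### `‖J(θ, s)‖ ≤ C s²` -/

omit hμ₁ hμ₂ in
/-- Second derivatives in the scale direction are bounded by the full second derivative of the lift:
`‖∂²_u Φ̂((θ,u),t)|_{u=s}‖ ≤ ‖D²Φ̂((θ,s),t)‖`. [folklore] -/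
theorem norm_iteratedDeriv_scale_le {F : (ℝ × ℝ) × MomSpace → ℂ} (hF : ContDiff ℝ ((⊤ : ℕ∞) : WithTop ℕ∞) F)
    (θ s : ℝ) (t : MomSpace) :
    ‖iteratedDeriv 2 (fun u : ℝ => F ((θ, u), t)) s‖ ≤ ‖iteratedFDeriv ℝ 2 F ((θ, s), t)‖ := by
  set L : ℝ →L[ℝ] (ℝ × ℝ) × MomSpace := (ContinuousLinearMap.inl ℝ (ℝ × ℝ) MomSpace).comp (ContinuousLinearMap.inr ℝ ℝ ℝ) with hL
  set q₀ : (ℝ × ℝ) × MomSpace := ((θ, 0), t) with hq₀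
  set h : (ℝ × ℝ) × MomSpace → ℂ := fun y => F (y + q₀) with hh
  have hhc : ContDiff ℝ ((⊤ : ℕ∞) : WithTop ℕ∞) h := hF.comp (contDiff_id.add contDiff_const)
  have hcomp : (fun u : ℝ => F ((θ, u), t)) = h ∘ L := by
    funext u
    simp [hh, hL, hq₀]
  have hLnorm : ‖L‖ ≤ 1 := by
    refine (ContinuousLinearMap.opNorm_comp_le _ _).trans ?_
    have h1 := ContinuousLinearMap.norm_inl_le_one ℝ (ℝ × ℝ) MomSpace
    have h2 := ContinuousLinearMap.norm_inr_le_one ℝ ℝ ℝ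
    exact mul_le_one₀ h1 (norm_nonneg _) h2
  rw [← norm_iteratedFDeriv_eq_norm_iteratedDeriv, hcomp,
    ContinuousLinearMap.iteratedFDeriv_comp_right _ hhc _ (WithTop.coe_le_coe.2 (le_top : (2 : ℕ∞) ≤ ⊤))]
  refine (ContinuousMultilinearMap.norm_compContinuousLinearMap_le _ _).trans ?_
  have hprod : ∏ _i : Fin 2, ‖L‖ ≤ 1 := Finset.prod_le_one (fun _ _ => norm_nonneg _) fun _ _ => hLnorm
  have hshift : iteratedFDeriv ℝ 2 h (L s) = iteratedFDeriv ℝ 2 F ((θ, s), t) := by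
    rw [hh, iteratedFDeriv_comp_add_right]
    congr 1
    simp [hL, hq₀]
  rw [hshift]
  exact mul_le_of_le_one_right (norm_nonneg _) hprod

/-- **`‖J(θ, s)‖ ≤ C s²`** for `θ ∈ [0, 2π]` and `|s| ≤ 1`, with `C` depending on `μ, e₀` only
(`J` is even in `s`, vanishes at `s = 0`, and the symmetric second differences of the integrand are
`O(s²)` uniformly on the support box). [cite: BenfattoGiulianiMastropietro2006, §2.5 Lemma 2.2a] -/
theorem norm_masterScaleIntegral_le {e₀ : ℝ} (he : 0 < e₀) (he' : e₀ ≤ (4 + μ) / 2) :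
    ∃ C : ℝ, 0 ≤ C ∧ ∀ θ ∈ Icc 0 (2 * π), ∀ s ∈ Icc (-1 : ℝ) 1, ‖masterScaleIntegral μ e₀ θ s‖ ≤ C * s ^ 2 := by
  -- a bound of the second derivative of the lift on the compact parameter × box set
  set P : Set (ℝ × ℝ) := Icc 0 (2 * π) ×ˢ Icc (-1 : ℝ) 1 with hP
  set T : Set MomSpace := {t | |t 0| ≤ e₀ ∧ |t 1| ≤ normalExtentConst μ e₀ ∧ |t 2| ≤ tangentExtentConst μ e₀} with hT
  have hK : IsCompact (P ×ˢ T) := (isCompact_Icc.prod isCompact_Icc).prod (isCompact_momBox _ _ _)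
  have hF := contDiff_masterLift hμ₁ hμ₂ he (μ := μ)
  have hcont : ContinuousOn (fun q : (ℝ × ℝ) × MomSpace => iteratedFDeriv ℝ 2 (masterLift μ e₀) q) (P ×ˢ T) :=
    (hF.continuous_iteratedFDeriv (WithTop.coe_le_coe.2 (le_top : (2 : ℕ∞) ≤ ⊤))).continuousOn
  obtain ⟨B, hB⟩ := hK.exists_bound_of_continuousOn hcont
  set B' : ℝ := max B 0 with hB'
  have hB'0 : 0 ≤ B' := le_max_right _ _
  -- the volume of the box
  set V : ℝ := (volume (masterBoxQ μ e₀)).toReal with hV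
  have hVfin : volume (masterBoxQ μ e₀) < ⊤ := (isCompact_masterBoxQ μ e₀).measure_lt_top
  refine ⟨B' * V, by positivity, fun θ hθ s hs => ?_⟩
  -- pointwise symmetric second differences
  set φ : QSpace → ℝ → ℂ := fun q u => masterSymbolQ μ e₀ θ u q with hφ
  have hφc : ∀ q, ContDiff ℝ 2 (φ q) := fun q => by
    have h1 : ContDiff ℝ ((⊤ : ℕ∞) : WithTop ℕ∞) fun u : ℝ => masterLift μ e₀ ((θ, u), WithLp.toLp 2 ![q.1, q.2.2, q.2.1]) :=
      hF.comp ((contDiff_const.prodMk contDiff_id).prodMk contDiff_const)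
    have h2 : (φ q) = fun u : ℝ => masterLift μ e₀ ((θ, u), WithLp.toLp 2 ![q.1, q.2.2, q.2.1]) := by
      funext u; exact masterSymbolQ_eq_masterLift μ e₀ θ u q
    rw [h2]; exact h1.of_le (WithTop.coe_le_coe.2 (le_top : (2 : ℕ∞) ≤ ⊤))
  have hpt : ∀ q, ‖φ q s + φ q (-s) - (2 : ℝ) • φ q 0‖ ≤ (masterBoxQ μ e₀).indicator (fun _ => 2 * B' * s ^ 2) q := by
    intro q
    by_cases hq : q ∈ masterBoxQ μ e₀
    · rw [indicator_of_mem hq]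
      refine symm_second_diff_le (hφc q) (fun u hu => ?_) hs
      have h2 : (φ q) = fun u : ℝ => masterLift μ e₀ ((θ, u), WithLp.toLp 2 ![q.1, q.2.2, q.2.1]) := by
        funext u; exact masterSymbolQ_eq_masterLift μ e₀ θ u q
      rw [h2]
      refine (norm_iteratedDeriv_scale_le hF θ u _).trans ((hB _ (mk_mem_prod ⟨hθ, hu⟩ ?_)).trans (le_max_left _ _))
      obtain ⟨hq1, hq2, hq3⟩ := hq
      exact ⟨by simpa using hq1, by simpa using hq2, by simpa using hq3⟩
    · rw [indicator_of_notMem hq]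
      have hs' : -s ∈ Icc (-1 : ℝ) 1 := ⟨by linarith [hs.2], by linarith [hs.1]⟩
      have h0 : (0 : ℝ) ∈ Icc (-1 : ℝ) 1 := ⟨by norm_num, by norm_num⟩
      simp only [hφ, masterSymbolQ_eq_zero_of_notMem hμ₁ hμ₂ he he' hs hq, masterSymbolQ_eq_zero_of_notMem hμ₁ hμ₂ he he' hs' hq,
        masterSymbolQ_eq_zero_of_notMem hμ₁ hμ₂ he he' h0 hq, smul_zero, add_zero, sub_zero, norm_zero, le_refl]
  -- `J(s) = ½ ∫ (φ(s) + φ(-s) - 2φ(0))`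
  have hs' : -s ∈ Icc (-1 : ℝ) 1 := ⟨by linarith [hs.2], by linarith [hs.1]⟩
  have h0 : (0 : ℝ) ∈ Icc (-1 : ℝ) 1 := ⟨by norm_num, by norm_num⟩
  have hi := integrable_masterSymbolQ hμ₁ hμ₂ he he' θ hs
  have hi' := integrable_masterSymbolQ hμ₁ hμ₂ he he' θ hs'
  have hi0 := integrable_masterSymbolQ hμ₁ hμ₂ he he' θ h0
  have hJ : masterScaleIntegral μ e₀ θ s = (1 / 2 : ℂ) * ∫ q, (φ q s + φ q (-s) - (2 : ℝ) • φ q 0) := by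
    have hsum : ∫ q, (φ q s + φ q (-s) - (2 : ℝ) • φ q 0) =
        masterScaleIntegral μ e₀ θ s + masterScaleIntegral μ e₀ θ (-s) - (2 : ℝ) • masterScaleIntegral μ e₀ θ 0 := by
      have e1 : ∫ q, (φ q s + φ q (-s) - (2 : ℝ) • φ q 0) = (∫ q, (φ q s + φ q (-s))) - ∫ q, (2 : ℝ) • φ q 0 :=
        integral_sub (hi.add hi') (hi0.smul (2 : ℝ))
      have e2 : ∫ q, (φ q s + φ q (-s)) = (∫ q, φ q s) + ∫ q, φ q (-s) := integral_add hi hi'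
      have e3 : ∫ q, (2 : ℝ) • φ q 0 = (2 : ℝ) • ∫ q, φ q 0 := integral_smul _ _
      rw [e1, e2, e3]
      rfl
    rw [hsum, masterScaleIntegral_neg hμ₁ hμ₂ he, masterScaleIntegral_zero hμ₁ hμ₂ he, smul_zero, sub_zero]
    ring
  -- integrate the pointwise bound
  have hind : Integrable ((masterBoxQ μ e₀).indicator fun _ : QSpace => 2 * B' * s ^ 2) volume :=
    (integrable_indicator_iff (isClosed_masterBoxQ μ e₀).measurableSet).2 (integrableOn_const hVfin.ne)
  have hnorm := norm_integral_le_of_norm_le hind (ae_of_all _ hpt)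
  rw [integral_indicator (isClosed_masterBoxQ μ e₀).measurableSet, setIntegral_const, smul_eq_mul] at hnorm
  rw [hJ, norm_mul]
  have h12 : ‖(1 / 2 : ℂ)‖ = 1 / 2 := by simp
  rw [h12]
  have : (volume (masterBoxQ μ e₀)).toReal = V := rfl
  calc 1 / 2 * ‖∫ q, (φ q s + φ q (-s) - (2 : ℝ) • φ q 0)‖ ≤ 1 / 2 * (V * (2 * B' * s ^ 2)) := by
        rw [← this]; exact mul_le_mul_of_nonneg_left hnorm (by norm_num)
    _ = B' * V * s ^ 2 := by ring

/-! ### The propagator at the origin -/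

/-- **`g^{(-n)}_ω(0, 0) = 4^{-n}4^{-n}2^{-n} · 4ⁿ · J(θ_{n,ω}, 2^{-n})`** (Fourier transform at `0` =
integral; affine change of variables to the rescaled symbol; the master identity). [cite: BenfattoGiulianiMastropietro2006, §2.5 Lemma 2.2a (2.56b)] -/
theorem sectorPropagator_zero_eq {e₀ : ℝ} (he : 0 < e₀) (he' : e₀ ≤ (4 + μ) / 2) (n : ℕ) (ω : ℤ) :
    sectorPropagator e₀ μ n ω 0 0 =
      ((((4 : ℝ) ^ (-(n : ℤ)) * (4 : ℝ) ^ (-(n : ℤ)) * (2 : ℝ) ^ (-(n : ℤ))) * (4 : ℝ) ^ n : ℝ) : ℂ) *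
        masterScaleIntegral μ e₀ (((ω : ℝ) + 1 / 2) * sectorWidth n) ((2 : ℝ) ^ (-(n : ℤ))) := by
  set θ₀ : ℝ := ((ω : ℝ) + 1 / 2) * sectorWidth n with hθ₀
  set A := sectorChart hμ₁ hμ₂ θ₀ n with hA
  have hdet : (4 : ℝ) ^ (-(n : ℤ)) * (4 : ℝ) ^ (-(n : ℤ)) * (2 : ℝ) ^ (-(n : ℤ)) > 0 := by positivity
  -- Fourier transform at `0`
  have h0 : dualPoint 0 0 = (0 : MomSpace) := by
    ext i; fin_cases i <;> simp [dualPoint]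
  rw [sectorPropagator_eq_fourier, h0, Real.fourier_eq']
  simp only [inner_zero_right, mul_zero, Complex.ofReal_zero, zero_mul, Complex.exp_zero, one_smul]
  -- affine change of variables
  rw [sectorSymbolE_eq_comp hμ₁ hμ₂]
  rw [show (∫ v : MomSpace, ((rescaledSectorSymbol hμ₁ hμ₂ e₀ n ω ∘ A.symm) ∘ fun q => q + -fermiBasePoint μ θ₀) v) =
      ∫ v : MomSpace, (rescaledSectorSymbol hμ₁ hμ₂ e₀ n ω ∘ A.symm) v from
    integral_add_right_eq_self (μ := (volume : Measure MomSpace)) (rescaledSectorSymbol hμ₁ hμ₂ e₀ n ω ∘ A.symm) _]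
  simp only [Function.comp_apply]
  rw [integral_comp_continuousLinearEquiv volume A.symm, det_sectorChart_symm hμ₁ hμ₂, inv_inv, abs_of_pos hdet]
  -- the master identity and the transfer to the scale integral
  rw [rescaledSectorSymbol_eq_smul_masterLift hμ₁ hμ₂ he he' n ω]
  simp only
  rw [integral_smul, integral_masterLift, smul_eq_mul, Complex.real_smul]
  push_cast
  ring

/-- **Lemma 2.2a of Benfatto–Giuliani–Mastropietro (2006)**: for `-4 < μ < -2 - √2`,
`0 < e₀ ≤ (4+μ)/2` there is `C` with `‖g^{(-n)}_ω(0, 0)‖ ≤ C · 4^{-n}4^{-n}2^{-n}` (`= Cγ^{(5/2)h}`)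
for all `n` and all sectors `0 ≤ ω < 2^{n+1}`. [cite: BenfattoGiulianiMastropietro2006, §2.5 Lemma 2.2a (2.56a)] -/
theorem norm_sectorPropagator_zero_le {e₀ : ℝ} (he : 0 < e₀) (he' : e₀ ≤ (4 + μ) / 2) :
    ∃ C : ℝ, 0 ≤ C ∧ ∀ (n : ℕ) (ω : ℕ), ω < sectorCount n →
      ‖sectorPropagator e₀ μ n ω 0 0‖ ≤ C * ((4 : ℝ) ^ (-(n : ℤ)) * (4 : ℝ) ^ (-(n : ℤ)) * (2 : ℝ) ^ (-(n : ℤ))) := by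
  obtain ⟨C, hC0, hC⟩ := norm_masterScaleIntegral_le hμ₁ hμ₂ he he'
  refine ⟨C, hC0, fun n ω hω => ?_⟩
  set θ₀ : ℝ := ((ω : ℝ) + 1 / 2) * sectorWidth n with hθ₀
  have hθ : θ₀ ∈ Icc 0 (2 * π) := by
    have hw := sectorWidth_pos n
    have hN := sectorCount_mul_sectorWidth n
    have hω' : (ω : ℝ) + 1 ≤ sectorCount n := by exact_mod_cast hω
    refine ⟨by positivity, ?_⟩
    calc ((ω : ℝ) + 1 / 2) * sectorWidth n ≤ (sectorCount n : ℝ) * sectorWidth n :=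
          mul_le_mul_of_nonneg_right (by linarith) hw.le
      _ = 2 * π := hN
  have hs1 : (2 : ℝ) ^ (-(n : ℤ)) ∈ Icc (-1 : ℝ) 1 :=
    ⟨by linarith [(zpow_pos (by norm_num : (0 : ℝ) < 2) (-(n : ℤ)))], zpow_le_one_of_nonpos₀ (by norm_num) (by simp)⟩
  have hs2 : ((2 : ℝ) ^ (-(n : ℤ))) ^ 2 = (4 : ℝ) ^ (-(n : ℤ)) := (four_zpow_neg_eq_sq n).symm
  have h44 : (4 : ℝ) ^ n * (4 : ℝ) ^ (-(n : ℤ)) = 1 := by rw [zpow_neg, zpow_natCast, mul_inv_cancel₀ (by positivity)]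
  have hJ := hC θ₀ hθ _ hs1
  have heq := sectorPropagator_zero_eq hμ₁ hμ₂ he he' n (ω : ℤ)
  rw [Int.cast_natCast] at heq
  rw [heq, norm_mul, Complex.norm_real, Real.norm_eq_abs, abs_of_pos (by positivity)]
  calc (4 : ℝ) ^ (-(n : ℤ)) * (4 : ℝ) ^ (-(n : ℤ)) * (2 : ℝ) ^ (-(n : ℤ)) * (4 : ℝ) ^ n *
        ‖masterScaleIntegral μ e₀ θ₀ ((2 : ℝ) ^ (-(n : ℤ)))‖
      ≤ (4 : ℝ) ^ (-(n : ℤ)) * (4 : ℝ) ^ (-(n : ℤ)) * (2 : ℝ) ^ (-(n : ℤ)) * (4 : ℝ) ^ n * (C * ((2 : ℝ) ^ (-(n : ℤ))) ^ 2) :=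
        mul_le_mul_of_nonneg_left hJ (by positivity)
    _ = C * ((4 : ℝ) ^ (-(n : ℤ)) * (4 : ℝ) ^ (-(n : ℤ)) * (2 : ℝ) ^ (-(n : ℤ))) * ((4 : ℝ) ^ n * (4 : ℝ) ^ (-(n : ℤ))) := by
        rw [hs2]; ring
    _ = C * ((4 : ℝ) ^ (-(n : ℤ)) * (4 : ℝ) ^ (-(n : ℤ)) * (2 : ℝ) ^ (-(n : ℤ))) := by rw [h44, mul_one]

end Main

end Literature.MathematicalPhysics.QuantumLattice

end
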